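import Literature.Analysis.FunctionSpaces.PoissonMeckeCylinders
import Mathlib.Probability.Independence.Basic
import Mathlib.Data.Fintype.Sigma
import HarnessLib

/-!
# Independence of the restrictions of a Poisson point process to disjoint sets

(topic Analysis/FunctionSpaces, next to `PoissonPointProcess` / `PoissonMeckeCylinders`; no new
definitions, no new named facts.)

Kingman, *Poisson Processes* (1993), §2.2 (Restriction Theorem and the remark following it): the
restrictions of a Poisson process `Π` to disjoint measurable sets `S₁, S₂, …` are independent
(Poisson) processes. Here we prove the independence half for the tree's predicate
`IsPoissonPointProcess ν P` on locally finite simple configurations `PointConfig E`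
(`PointConfig.instMeasurableSpace` = the σ-algebra generated by the counts `N(t)`, `t` measurable):

* `IsPoissonPointProcess.iIndepFun_restrict`: for pairwise disjoint measurable `s i`, `i : Fin n`,
  the restriction maps `c ↦ c ∩ s i` are mutually independent under `P`, i.e. the σ-algebras
  `σ(c ↦ c ∩ s i)` of events *depending only on the configuration inside `s i`* are independent;
* `IsPoissonPointProcess.indepFun_restrict`: the case of two disjoint sets.

No intensity hypothesis (σ-finiteness, finiteness on the `s i`) is needed: only axiom (ii) of
Kingman's definition (independence of the counts of pairwise disjoint measurable sets) is used.

## Proof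

The σ-algebra `σ(c ↦ c ∩ s)` is generated by the π-system of *count cylinders over `s`*,
`{c | (N_c(u j))_j ∈ T}` for finite families `u j ⊆ s` of measurable sets
(`PointConfig.comap_restrict_eq_generateFrom`, `PointConfig.isPiSystem_countCylindersIn`; note
`N_{c ∩ s}(t) = N_c(s ∩ t)`). Given one cylinder per region, refine each family `(u i j)_j` into its
atoms `s i ∩ ⋂_j (u i j)^{±}` (Kingman 1993, §2.1, the disjoint sets `A₁* ∩ ⋯ ∩ Aₙ*`); all atoms
together form a pairwise disjoint family, so their counts are independent by axiom (ii); grouping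
the atom counts region by region keeps independence (`iIndepFun_pi_of_sigma`, boxes form generating
π-systems), and each `N(u i j)` is the sum of the atom counts of region `i` selecting `j`
(`PointConfig.count_eq_sum_count_atom`), whence the count vectors `(N(u i j))_j`, `i : Fin n`, are
independent (`IsPoissonPointProcess.iIndepFun_count_pi`) and the product formula holds on the
cylinders; `ProbabilityTheory.iIndepSets.iIndep` concludes.

## Not here

The other half of Kingman's Restriction Theorem — the restricted process `Π ∩ S` is Poisson with
intensity `ν|_S` — is the named fact `IsPoissonPointProcess.restrict` (file `PoissonPointProcess`,
discharged by `IsPoissonPointProcess.restrict_holds` in `PoissonPointProcessProofs`) and is not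
used here.

## References

* J. F. C. Kingman, *Poisson Processes*, Oxford University Press (1993), §2.1 (definition, the
  disjoint refinements `A₁* ∩ ⋯ ∩ Aₙ*`), §2.2 (Restriction Theorem: independence of the
  restrictions to disjoint sets). [cite: Kingman1993, §2.2]
-/

open MeasureTheory ProbabilityTheory Set
open scoped ENNReal

namespace Literature.Analysis.FunctionSpaces

/-! ## Grouping independent random variables into independent random vectors -/

/-- **Grouping preserves independence.** If the random variables `f i j` (`i : ι`, `j : κ i` with
each `κ i` finite) are mutually independent as a family indexed by `Σ i, κ i`, then the random
vectors `ω ↦ (f i j ω)_j`, `i : ι`, are mutually independent: the boxes `⋂ⱼ (f i j)⁻¹ Cⱼ` form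
generating π-systems of the σ-algebras `σ((f i j)_j)`, and on boxes the product formula is the one
of the flattened family, re-bracketed (`Finset.prod_sigma`). (Cf. `iIndepFun.pi` of the PFR
project; Mathlib has the two-block `iIndepFun.indepFun_finset`.) [folklore] -/
theorem iIndepFun_pi_of_sigma {Ω ι β : Type*} {mΩ : MeasurableSpace Ω} {μ : Measure Ω}
    {κ : ι → Type*} [∀ i, Fintype (κ i)] {mβ : MeasurableSpace β} {f : ∀ i, κ i → Ω → β}
    (hf : ∀ i j, Measurable (f i j)) (h : iIndepFun (fun p : Σ i, κ i => f p.1 p.2) μ) :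
    iIndepFun (fun i ω (j : κ i) => f i j ω) μ := by
  classical
  rw [iIndepFun_iff_iIndep]
  refine iIndepSets.iIndep (fun i => (measurable_pi_lambda _ (hf i)).comap_le)
    (fun i => {A | ∃ C : κ i → Set β, (∀ j, MeasurableSet (C j)) ∧ A = ⋂ j, f i j ⁻¹' C j})
    ?_ ?_ ?_
  · -- boxes form a π-system
    rintro i _ ⟨C, hC, rfl⟩ _ ⟨C', hC', rfl⟩ -
    refine ⟨fun j => C j ∩ C' j, fun j => (hC j).inter (hC' j), ?_⟩
    ext ω
    simp only [mem_inter_iff, mem_iInter, mem_preimage]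
    exact forall_and.symm
  · -- boxes generate `σ((f i j)_j)`
    intro i
    have hbox : ∀ C : κ i → Set β,
        (fun ω (j : κ i) => f i j ω) ⁻¹' Set.pi univ C = ⋂ j, f i j ⁻¹' C j := fun C => by
      ext ω
      simp
    have hpi : (MeasurableSpace.pi : MeasurableSpace (κ i → β)) = MeasurableSpace.generateFrom
        (Set.pi univ '' Set.pi univ fun _ : κ i => {C : Set β | MeasurableSet C}) :=
      generateFrom_pi.symm
    rw [hpi, MeasurableSpace.comap_generateFrom]
    apply le_antisymm
    · refine MeasurableSpace.generateFrom_le ?_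
      rintro _ ⟨_, ⟨C, hC, rfl⟩, rfl⟩
      exact MeasurableSpace.measurableSet_generateFrom
        ⟨C, fun j => hC j (mem_univ j), hbox C⟩
    · refine MeasurableSpace.generateFrom_le ?_
      rintro _ ⟨C, hC, rfl⟩
      exact MeasurableSpace.measurableSet_generateFrom
        ⟨Set.pi univ C, ⟨C, fun j _ => hC j, rfl⟩, hbox C⟩
  · -- the product formula on boxes
    refine (iIndepSets_iff _ _).2 fun S A hA => ?_
    have hA' : ∀ i, ∃ C : κ i → Set β, (∀ j, MeasurableSet (C j)) ∧
        (i ∈ S → A i = ⋂ j, f i j ⁻¹' C j) := fun i => by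
      by_cases hi : i ∈ S
      · obtain ⟨C, hC, hAC⟩ := hA i hi
        exact ⟨C, hC, fun _ => hAC⟩
      · exact ⟨fun _ => univ, fun _ => MeasurableSet.univ, fun hi' => absurd hi' hi⟩
    choose C hC hAC using hA'
    have key : ∀ S' : Finset ι,
        μ (⋂ i ∈ S', ⋂ j, f i j ⁻¹' C i j) = ∏ i ∈ S', ∏ j, μ (f i j ⁻¹' C i j) := fun S' => by
      have h1 := h.measure_inter_preimage_eq_mul (S'.sigma fun _ => Finset.univ)
        (sets := fun p => C p.1 p.2) fun p _ => hC p.1 p.2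
      rw [Finset.prod_sigma] at h1
      rw [Set.biInter_finsetSigma_univ']
      exact h1
    rw [Set.iInter₂_congr hAC, key S]
    refine Finset.prod_congr rfl fun i hi => ?_
    rw [hAC i hi]
    simpa using (key {i}).symm

variable {E : Type*} [TopologicalSpace E] [MeasurableSpace E]

/-! ## Count cylinders over a region: a generating π-system of `σ(c ↦ c ∩ s)` -/

namespace PointConfig

/-- **Count cylinders over a region form a π-system.** The events `{c | (N_c(u j))_j ∈ T}`,
`u : Fin k → Set E` a finite family of measurable subsets of `s`, `T` any set of count vectors, are
closed under intersection (concatenate the families, `Fin.append`). (Kingman 1993, §2.1–2.2: the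
joint distributions of the counts of subsets of `s` determine the restricted process.)
[cite: Kingman1993, §2.2] -/
theorem isPiSystem_countCylindersIn (s : Set E) :
    IsPiSystem {A : Set (PointConfig E) | ∃ (k : ℕ) (u : Fin k → Set E) (T : Set (Fin k → ℕ∞)),
      (∀ j, MeasurableSet (u j) ∧ u j ⊆ s) ∧
      A = (fun (c : PointConfig E) (j : Fin k) => c.count (u j)) ⁻¹' T} := by
  rintro _ ⟨k, u, T, hu, rfl⟩ _ ⟨k', u', T', hu', rfl⟩ -
  refine ⟨k + k', Fin.append u u',
    {v | (fun j => v (Fin.castAdd k' j)) ∈ T ∧ (fun j => v (Fin.natAdd k j)) ∈ T'},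
    fun j => ?_, ?_⟩
  · induction j using Fin.addCases with
    | left i => simpa only [Fin.append_left] using hu i
    | right i => simpa only [Fin.append_right] using hu' i
  · ext c
    simp only [mem_inter_iff, mem_preimage, mem_setOf_eq, Fin.append_left, Fin.append_right]

/-- **Events depending only on the configuration inside `s` are generated by the count cylinders
over `s`.** For measurable `s`, the pull-back `σ(c ↦ c ∩ s)` of the count σ-algebra under
restriction to `s` is generated by the cylinders `{c | (N_c(u j))_j ∈ T}` with finitely many
measurable `u j ⊆ s`: `N_{c ∩ s}(t) = N_c(s ∩ t)` (`count_restrict`) gives `≤`, and for `u ⊆ s`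
the count `N_c(u) = N_{c ∩ s}(u)` factors through the restriction, giving `≥`.
(Kingman 1993, §2.2, the restricted process `Π ∩ S` and its counts.) [cite: Kingman1993, §2.2] -/
theorem comap_restrict_eq_generateFrom {s : Set E} (hs : MeasurableSet s) :
    MeasurableSpace.comap (PointConfig.restrict s)
        (PointConfig.instMeasurableSpace : MeasurableSpace (PointConfig E)) =
      MeasurableSpace.generateFrom {A : Set (PointConfig E) | ∃ (k : ℕ) (u : Fin k → Set E)
        (T : Set (Fin k → ℕ∞)), (∀ j, MeasurableSet (u j) ∧ u j ⊆ s) ∧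
        A = (fun (c : PointConfig E) (j : Fin k) => c.count (u j)) ⁻¹' T} := by
  apply le_antisymm
  · change MeasurableSpace.comap _ (⨆ (t : Set E) (_ : MeasurableSet t), _) ≤ _
    simp only [MeasurableSpace.comap_iSup, MeasurableSpace.comap_comp]
    refine iSup₂_le fun t ht => ?_
    intro A hA
    obtain ⟨B, -, rfl⟩ := MeasurableSpace.measurableSet_comap.1 hA
    refine MeasurableSpace.measurableSet_generateFrom ⟨1, fun _ => s ∩ t, {v | v 0 ∈ B},
      fun _ => ⟨hs.inter ht, inter_subset_left⟩, ?_⟩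
    ext c
    simp [PointConfig.count_restrict]
  · refine MeasurableSpace.generateFrom_le ?_
    rintro _ ⟨k, u, T, hu, rfl⟩
    have hfac : (fun (c : PointConfig E) (j : Fin k) => c.count (u j)) =
        (fun (d : PointConfig E) (j : Fin k) => d.count (u j)) ∘ PointConfig.restrict s := by
      funext c j
      simp only [Function.comp_apply, PointConfig.count_restrict, inter_eq_right.2 (hu j).2]
    rw [hfac]
    exact ((measurable_pi_lambda _ fun j => PointConfig.measurable_count (hu j).1).comp
      (Measurable.of_comap_le le_rfl)) T.to_countable.measurableSet

end PointConfig

/-! ## Independence over disjoint regions -/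

namespace IsPoissonPointProcess

variable {ν : Measure E} {P : Measure (PointConfig E)}

/-- Kingman's axiom (ii) for a family indexed by a finite type: under a Poisson point process the
counts of finitely many pairwise disjoint measurable sets are mutually independent (reindex by
`Fin (card κ)`; Kingman 1993, §2.1). [cite: Kingman1993, §2.1] -/
theorem iIndepFun_count_fintype (h : IsPoissonPointProcess ν P) {κ : Type*} [Fintype κ]
    {t : κ → Set E} (ht : ∀ k, MeasurableSet (t k)) (hd : Pairwise (Function.onFun Disjoint t)) :
    iIndepFun (fun k (c : PointConfig E) => c.count (t k)) P := by
  have h1 := h.iIndepFun_count (s := fun i => t ((Fintype.equivFin κ).symm i)) (fun i => ht _)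
    (fun i j hij => hd ((Fintype.equivFin κ).symm.injective.ne hij))
  exact iIndepFun.of_precomp (Fintype.equivFin κ).symm.surjective h1

/-- **Count vectors of subsets of disjoint regions are independent** (the finite-dimensional form
of the independence of the restrictions, Kingman 1993, §2.2). For pairwise disjoint measurable
`s i`, `i : Fin n`, and finite families `u i j ⊆ s i` of measurable sets, the count vectors
`c ↦ (N_c(u i j))_j` are mutually independent under a Poisson point process: the atoms
`s i ∩ ⋂_j (u i j)^{±}` of all regions form one pairwise disjoint family (Kingman 1993, §2.1,
`A₁* ∩ ⋯ ∩ Aₙ*`), whose counts are independent by axiom (ii); group them by region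
(`iIndepFun_pi_of_sigma`) and sum (`N(u i j) = ∑_{w j} N(atom w)`,
`PointConfig.count_eq_sum_count_atom`). [cite: Kingman1993, §2.2] -/
theorem iIndepFun_count_pi (h : IsPoissonPointProcess ν P) {n : ℕ} {s : Fin n → Set E}
    (hs : ∀ i, MeasurableSet (s i)) (hd : Pairwise (Function.onFun Disjoint s)) {k : Fin n → ℕ}
    {u : ∀ i, Fin (k i) → Set E} (hum : ∀ i j, MeasurableSet (u i j))
    (hus : ∀ i j, u i j ⊆ s i) :
    iIndepFun (fun i (c : PointConfig E) (j : Fin (k i)) => c.count (u i j)) P := by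
  -- the atoms of the family `u i` inside the region `s i`
  set a : ∀ i, (Fin (k i) → Bool) → Set E :=
    fun i w => s i ∩ ⋂ j, bif w j then u i j else (u i j)ᶜ
  have ham : ∀ i w, MeasurableSet (a i w) := fun i w =>
    (hs i).inter (PointConfig.measurableSet_atom (u i) (hum i) w)
  -- all atoms together are pairwise disjoint
  have had : Pairwise (Function.onFun Disjoint fun p : Σ i, (Fin (k i) → Bool) => a p.1 p.2) := by
    rintro ⟨i, w⟩ ⟨i', w'⟩ hne
    change Disjoint (a i w) (a i' w')
    by_cases hii' : i = i'
    · subst hii'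
      have hww' : w ≠ w' := fun hw => hne (by rw [hw])
      exact (PointConfig.disjoint_atom (u i) hww').mono inter_subset_right inter_subset_right
    · exact (hd hii').mono inter_subset_left inter_subset_left
  -- so their counts are independent (axiom (ii)), and stay independent grouped by region
  have hind : iIndepFun (fun (p : Σ i, (Fin (k i) → Bool)) (c : PointConfig E) =>
      c.count (a p.1 p.2)) P :=
    h.iIndepFun_count_fintype (t := fun p : Σ i, (Fin (k i) → Bool) => a p.1 p.2)
      (fun p => ham p.1 p.2) had
  have hblock : iIndepFun (fun i (c : PointConfig E) (w : Fin (k i) → Bool) => c.count (a i w)) P :=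
    iIndepFun_pi_of_sigma (f := fun i w (c : PointConfig E) => c.count (a i w))
      (fun i w => PointConfig.measurable_count (ham i w)) hind
  -- each `N(u i j)` is the sum of the atom counts of region `i` selecting `j`
  have hsum : ∀ i (c : PointConfig E) (j : Fin (k i)), c.count (u i j) =
      ∑ w ∈ Finset.univ.filter (fun w : Fin (k i) → Bool => w j = true), c.count (a i w) := by
    intro i c j
    have h1 := PointConfig.count_eq_sum_count_atom (u i) (c.restrict (s i)) j
    simp only [PointConfig.count_restrict, inter_eq_right.2 (hus i j)] at h1
    exact h1
  have heq : (fun i (c : PointConfig E) (j : Fin (k i)) => c.count (u i j)) = fun i =>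
      (fun (v : (Fin (k i) → Bool) → ℕ∞) (j : Fin (k i)) =>
        ∑ w ∈ Finset.univ.filter (fun w : Fin (k i) → Bool => w j = true), v w) ∘
      fun (c : PointConfig E) (w : Fin (k i) → Bool) => c.count (a i w) := by
    funext i c j
    simp only [Function.comp_apply]
    exact hsum i c j
  rw [heq]
  exact hblock.comp _ fun i => measurable_of_countable _

/-- **Independence of the restrictions to disjoint sets** (Kingman, *Poisson Processes* (1993),
§2.2: "the restrictions of `Π` to disjoint measurable subsets are independent"), finite-family
form. Under a Poisson point process `P` with any intensity, for pairwise disjoint measurable sets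
`s i`, `i : Fin n`, the restriction maps `c ↦ c ∩ s i` are mutually independent, i.e. the
σ-algebras `σ(c ↦ c ∩ s i)` of events depending only on the configuration inside `s i` are
independent. Proof: the count cylinders over `s i` are generating π-systems
(`PointConfig.comap_restrict_eq_generateFrom`, `PointConfig.isPiSystem_countCylindersIn`) on which
the product formula is `iIndepFun_count_pi`; conclude by `ProbabilityTheory.iIndepSets.iIndep`.
[cite: Kingman1993, §2.2] -/
theorem iIndepFun_restrict (h : IsPoissonPointProcess ν P) {n : ℕ} {s : Fin n → Set E}
    (hs : ∀ i, MeasurableSet (s i)) (hd : Pairwise (Function.onFun Disjoint s)) :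
    ProbabilityTheory.iIndepFun (fun i => PointConfig.restrict (s i)) P := by
  rw [iIndepFun_iff_iIndep]
  refine iIndepSets.iIndep (fun i => (PointConfig.measurable_restrict (hs i)).comap_le)
    (fun i => {A : Set (PointConfig E) | ∃ (k : ℕ) (u : Fin k → Set E) (T : Set (Fin k → ℕ∞)),
      (∀ j, MeasurableSet (u j) ∧ u j ⊆ s i) ∧
      A = (fun (c : PointConfig E) (j : Fin k) => c.count (u j)) ⁻¹' T})
    (fun i => PointConfig.isPiSystem_countCylindersIn (s i))
    (fun i => PointConfig.comap_restrict_eq_generateFrom (hs i)) ?_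
  refine (iIndepSets_iff _ _).2 fun S A hA => ?_
  -- one cylinder per region (the empty family outside `S`)
  have hA' : ∀ i, ∃ (k : ℕ) (u : Fin k → Set E) (T : Set (Fin k → ℕ∞)),
      (∀ j, MeasurableSet (u j) ∧ u j ⊆ s i) ∧
      (i ∈ S → A i = (fun (c : PointConfig E) (j : Fin k) => c.count (u j)) ⁻¹' T) := fun i => by
    by_cases hi : i ∈ S
    · obtain ⟨k, u, T, hu, hAi⟩ := hA i hi
      exact ⟨k, u, T, hu, fun _ => hAi⟩
    · exact ⟨0, Fin.elim0, univ, fun j => j.elim0, fun hi' => absurd hi' hi⟩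
  choose k u T hu hAT using hA'
  have hind := h.iIndepFun_count_pi hs hd (u := u) (fun i j => (hu i j).1) fun i j => (hu i j).2
  calc P (⋂ i ∈ S, A i)
      = P (⋂ i ∈ S, (fun (c : PointConfig E) (j : Fin (k i)) => c.count (u i j)) ⁻¹' T i) := by
        rw [iInter₂_congr hAT]
    _ = ∏ i ∈ S, P ((fun (c : PointConfig E) (j : Fin (k i)) => c.count (u i j)) ⁻¹' T i) :=
        hind.measure_inter_preimage_eq_mul S fun i _ => (T i).to_countable.measurableSet
    _ = ∏ i ∈ S, P (A i) := Finset.prod_congr rfl fun i hi => by rw [hAT i hi]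

/-- **Independence of the restrictions to two disjoint sets** (Kingman, *Poisson Processes*
(1993), §2.2). Under a Poisson point process `P` with any intensity, for disjoint measurable `s`,
`t` the restriction maps `c ↦ c ∩ s` and `c ↦ c ∩ t` are independent: an event depending only on
the configuration inside `s` is independent of one depending only on the configuration inside `t`
(the case `n = 2` of `iIndepFun_restrict`). [cite: Kingman1993, §2.2] -/
theorem indepFun_restrict (h : IsPoissonPointProcess ν P) {s t : Set E} (hs : MeasurableSet s)
    (ht : MeasurableSet t) (hst : Disjoint s t) :
    ProbabilityTheory.IndepFun (PointConfig.restrict s) (PointConfig.restrict t) P := by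
  have h2 := h.iIndepFun_restrict (s := ![s, t]) (fun i => by fin_cases i; exacts [hs, ht])
    (fun i j hij => by
      fin_cases i <;> fin_cases j
      · exact absurd rfl hij
      · exact hst
      · exact hst.symm
      · exact absurd rfl hij)
  exact h2.indepFun (i := 0) (j := 1) Fin.zero_ne_one

end IsPoissonPointProcess

end Literature.Analysis.FunctionSpaces
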